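import Summits.Ventures.CertifiedManyBodySolver.Downfold.EmeryFermiFillingHg1212Subs
import Summits.Ventures.CertifiedManyBodySolver.Downfold.EmeryFermiFillingLa214
import Summits.Ventures.CertifiedManyBodySolver.Downfold.EmeryFermiFillingBi2212
import Summits.Ventures.CertifiedManyBodySolver.Downfold.EmeryBoxesKSlicesG
import HarnessLib

/-!
# HgBa₂CaCu₂O₆₊δ (box #257 Hg-1212, (K) source rows): the typed 3BE one-body box `emeryBoxHg1212K26Src` ⇒ a CERTIFIED window for the object-E Fermi-surface `t′/t` of the σ three-band
# model at the box's own hole count — and a certified MODEL-FORM CEILING against the E row of record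

Venture CertifiedManyBodySolver, cell `pub/hubbard-downfold` (stage S1, HUMAN RULINGS D-0096/D-0098), seat hubbard-downfold-mod-4 (technique B = band level);
namespace `Summit.Ventures.CertifiedManyBodySolver.Downfold.Emery`. Everything PROVED; numerics decided by the kernel (`EmeryFermiFillingHg1212Subs`).
Same device as `EmeryFermiFillingLa214` / `EmeryFermiFillingHg1201` / `EmeryFermiFillingLSCO`.

THE STATEMENT (`emeryBoxHg1212K26Src_fsRatio_window`). For every parameter vector of `emeryBoxHg1212K26Src` (`EmeryBoxesKSlicesG`: the Hg-1212 companion's ONE-BODY rows with the DFT-level Δ_pd sub-range (source box of the (K) U-slice), n_H ∈ [1.16, 1.20]: Δ_pd [1.85, 2.45] × t_pd [1.205, 1.28] × t_pp [0.644, 0.663] × t_pp′ [0.163, 0.187]; n_H ∈ [1.16, 1.2])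
and every Fermi energy ε with `abFilling(ε) = (2 − n_H)/2` (the σ-model antibonding band holds the box's own electrons):
**`t′/t = fsRatio(ε) ∈ [-0.3064, -0.2689]`** and **ε ∈ [1.24, 1.82]** (box units, eV above ε_d).

READING (certified): the box's object-E row of record `t′/t (E) ∈ [−0.524, −0.423]` (box HgBa2CaCu2O6.md l.21) vs the σ-model Fermi-surface window [-0.3064, -0.2689] on the whole one-body box at its own hole count —
see the corollary below: DISJOINT ⇒ a certified MODEL-FORM CEILING (the d–p_x–p_y(+t_pp, t_pp′) model cannot produce the one-band Fermi-surface shape of record anywhere in the box;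
the axial Cu-4s / apical / reservoir channel of [PavariniEtAl2001] carries the rest); INSIDE ⇒ consistency; partial overlap ⇒ a cut by sub-box (table in the Subs file).

WHAT THIS IS NOT: not a statement that the material's parameters ARE in the box (SCREENING-GRADE provenance); the theorem certifies the REDUCTION STEP
of the σ d–p_x–p_y(+t_pp, t_pp′) model only; not the interaction (`U`) reduction; no phase sentence. Sources: [HybertsenSchluterChristensen1989, Eq. (1)];
[AndersenEtAl1995, §6]; [PavariniEtAl2001, Eq. (1)].
-/

noncomputable section

namespace Summit.Ventures.CertifiedManyBodySolver.Downfold.Emery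

open Real Set
open Summit.Ventures.CertifiedManyBodySolver.Downfold

/-- **HgBa₂CaCu₂O₆₊δ (box #257 Hg-1212, (K) source rows): 3BE box ⇒ object-E `t′/t` window (raw coordinates)** at per-spin filling ∈ [0.4, 0.42]:
`ε ∈ [1.24, 1.82]` and `t′/t ∈ [-0.3064, -0.2689]`. [folklore] -/
theorem hg1212Box_fsRatio_window {Δ tpd tpp c ε : ℝ} (hΔ : Δ ∈ Set.Icc (37 / 20 : ℝ) (49 / 20 : ℝ))
    (ha : tpd ∈ Set.Icc (241 / 200 : ℝ) (32 / 25 : ℝ)) (hb : tpp ∈ Set.Icc (161 / 250 : ℝ) (663 / 1000 : ℝ))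
    (hc : c ∈ Set.Icc (163 / 1000 : ℝ) (187 / 1000 : ℝ))
    (hν : abFilling Δ tpd tpp c ε ∈ Set.Icc (2 / 5 : ℝ) (21 / 50 : ℝ)) :
    ε ∈ Set.Icc (31 / 25 : ℝ) (91 / 50 : ℝ) ∧ fsRatio Δ tpd tpp c ε ∈ Set.Icc (-(383 / 1250 : ℝ)) (-(2689 / 10000 : ℝ)) := by
  have hΔ' := hΔ
  constructor
  · clear hΔ
    rcases mem_Icc_split hΔ' (43 / 20 : ℝ) with hΔ' | hΔ'
    · rcases mem_Icc_split hΔ' (2 : ℝ) with hΔ' | hΔ'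
      · rcases mem_Icc_split ha (497 / 400 : ℝ) with ha' | ha'
        · have h := (hg1212Sub_0_0 hΔ' ha' hb hc hν).1
          exact ⟨le_trans (by norm_num) h.1, h.2.trans (by norm_num)⟩
        · have h := (hg1212Sub_0_1 hΔ' ha' hb hc hν).1
          exact ⟨le_trans (by norm_num) h.1, h.2.trans (by norm_num)⟩
      · rcases mem_Icc_split ha (497 / 400 : ℝ) with ha' | ha'
        · have h := (hg1212Sub_1_0 hΔ' ha' hb hc hν).1
          exact ⟨le_trans (by norm_num) h.1, h.2.trans (by norm_num)⟩
        · have h := (hg1212Sub_1_1 hΔ' ha' hb hc hν).1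
          exact ⟨le_trans (by norm_num) h.1, h.2.trans (by norm_num)⟩
    · rcases mem_Icc_split hΔ' (23 / 10 : ℝ) with hΔ' | hΔ'
      · rcases mem_Icc_split ha (497 / 400 : ℝ) with ha' | ha'
        · have h := (hg1212Sub_2_0 hΔ' ha' hb hc hν).1
          exact ⟨le_trans (by norm_num) h.1, h.2.trans (by norm_num)⟩
        · have h := (hg1212Sub_2_1 hΔ' ha' hb hc hν).1
          exact ⟨le_trans (by norm_num) h.1, h.2.trans (by norm_num)⟩
      · rcases mem_Icc_split ha (497 / 400 : ℝ) with ha' | ha'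
        · have h := (hg1212Sub_3_0 hΔ' ha' hb hc hν).1
          exact ⟨le_trans (by norm_num) h.1, h.2.trans (by norm_num)⟩
        · have h := (hg1212Sub_3_1 hΔ' ha' hb hc hν).1
          exact ⟨le_trans (by norm_num) h.1, h.2.trans (by norm_num)⟩
  · clear hΔ
    rcases mem_Icc_split hΔ' (43 / 20 : ℝ) with hΔ' | hΔ'
    · rcases mem_Icc_split hΔ' (2 : ℝ) with hΔ' | hΔ'
      · rcases mem_Icc_split ha (497 / 400 : ℝ) with ha' | ha'
        · have h := (hg1212Sub_0_0 hΔ' ha' hb hc hν).2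
          exact ⟨le_trans (by norm_num) h.1, h.2.trans (by norm_num)⟩
        · have h := (hg1212Sub_0_1 hΔ' ha' hb hc hν).2
          exact ⟨le_trans (by norm_num) h.1, h.2.trans (by norm_num)⟩
      · rcases mem_Icc_split ha (497 / 400 : ℝ) with ha' | ha'
        · have h := (hg1212Sub_1_0 hΔ' ha' hb hc hν).2
          exact ⟨le_trans (by norm_num) h.1, h.2.trans (by norm_num)⟩
        · have h := (hg1212Sub_1_1 hΔ' ha' hb hc hν).2
          exact ⟨le_trans (by norm_num) h.1, h.2.trans (by norm_num)⟩
    · rcases mem_Icc_split hΔ' (23 / 10 : ℝ) with hΔ' | hΔ'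
      · rcases mem_Icc_split ha (497 / 400 : ℝ) with ha' | ha'
        · have h := (hg1212Sub_2_0 hΔ' ha' hb hc hν).2
          exact ⟨le_trans (by norm_num) h.1, h.2.trans (by norm_num)⟩
        · have h := (hg1212Sub_2_1 hΔ' ha' hb hc hν).2
          exact ⟨le_trans (by norm_num) h.1, h.2.trans (by norm_num)⟩
      · rcases mem_Icc_split ha (497 / 400 : ℝ) with ha' | ha'
        · have h := (hg1212Sub_3_0 hΔ' ha' hb hc hν).2
          exact ⟨le_trans (by norm_num) h.1, h.2.trans (by norm_num)⟩
        · have h := (hg1212Sub_3_1 hΔ' ha' hb hc hν).2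
          exact ⟨le_trans (by norm_num) h.1, h.2.trans (by norm_num)⟩

/-- The five rows of `emeryBoxHg1212K26Src` this file reads. [folklore] -/
theorem emeryBoxHg1212K26Src_mem_rows {p : EmeryCoord → ℝ} (hp : emeryBoxHg1212K26Src.Mem p) :
    p .DeltaPd ∈ Set.Icc (37 / 20 : ℝ) (49 / 20 : ℝ) ∧ p .tpd ∈ Set.Icc (241 / 200 : ℝ) (32 / 25 : ℝ) ∧
      p .tpp ∈ Set.Icc (161 / 250 : ℝ) (663 / 1000 : ℝ) ∧ p .tppP ∈ Set.Icc (163 / 1000 : ℝ) (187 / 1000 : ℝ) ∧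
      p .nHoles ∈ Set.Icc (29 / 25 : ℝ) (6 / 5 : ℝ) := by
  have hΔ := (Entry.mem_ofEnds_iff _ _ _ _ _).1 (hp .DeltaPd hg1212K26Emery_DeltaKS rfl)
  have ha := (Entry.mem_ofEnds_iff _ _ _ _ _).1 (hp .tpd hg1212K26Emery_tpd rfl)
  have hb := (Entry.mem_ofEnds_iff _ _ _ _ _).1 (hp .tpp hg1212K26Emery_tpp rfl)
  have hc := (Entry.mem_ofEnds_iff _ _ _ _ _).1 (hp .tppP hg1212K26Emery_tppP rfl)
  have hn := (Entry.mem_ofEnds_iff _ _ _ _ _).1 (hp .nHoles hg1212K26Emery_nH rfl)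
  push_cast at hΔ ha hb hc hn
  exact ⟨⟨hΔ.1, hΔ.2⟩, ⟨ha.1, ha.2⟩, ⟨hb.1, hb.2⟩, ⟨hc.1, hc.2⟩, ⟨hn.1, hn.2⟩⟩

/-- **THE WORD ON THE TYPED BOX `emeryBoxHg1212K26Src`**: at every parameter vector and every Fermi energy at which the σ-model antibonding band holds the
box's own electron count, `ε ∈ [1.24, 1.82]` and the exact σ-model Fermi-surface `t′/t ∈ [-0.3064, -0.2689]`.
[cite: HybertsenSchluterChristensen1989, Eq. (1) (three-band d–p model)] -/
theorem emeryBoxHg1212K26Src_fsRatio_window :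
    HoldsOn (fun p : EmeryCoord → ℝ => ∀ ε : ℝ,
      abFilling (p .DeltaPd) (p .tpd) (p .tpp) (p .tppP) ε = (2 - p .nHoles) / 2 →
      ε ∈ Set.Icc (31 / 25 : ℝ) (91 / 50 : ℝ) ∧
      fsRatio (p .DeltaPd) (p .tpd) (p .tpp) (p .tppP) ε ∈ Set.Icc (-(383 / 1250 : ℝ)) (-(2689 / 10000 : ℝ))) emeryBoxHg1212K26Src := by
  intro p hp ε hf
  obtain ⟨hΔ, ha, hb, hc, hn⟩ := emeryBoxHg1212K26Src_mem_rows hp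
  exact hg1212Box_fsRatio_window hΔ ha hb hc (abFilling_rowBi2212_of_nHoles hn.1 hn.2 hf)

/-- **MODEL-FORM CEILING, CERTIFIED**: on the whole box the σ-model Fermi-surface `t′/t` window [-0.3064, -0.2689] is DISJOINT from the object-E
row of record `[-0.524, -0.423]` (router/BOXES/HgBa2CaCu2O6.md l.21 «tp/t (E) [−0.524, −0.423]») — the d–p_x–p_y(+t_pp, t_pp′) model cannot produce this material's one-band Fermi-surface
shape anywhere in its 3BE box. [folklore] -/
theorem emeryBoxHg1212K26Src_fsRatio_not_objectE :
    HoldsOn (fun p : EmeryCoord → ℝ => ∀ ε : ℝ,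
      abFilling (p .DeltaPd) (p .tpd) (p .tpp) (p .tppP) ε = (2 - p .nHoles) / 2 →
      fsRatio (p .DeltaPd) (p .tpd) (p .tpp) (p .tppP) ε ∉ Set.Icc (-(131 / 250 : ℝ)) (-(423 / 1000 : ℝ))) emeryBoxHg1212K26Src := by
  intro p hp ε hf hmem
  have h := (emeryBoxHg1212K26Src_fsRatio_window p hp ε hf).2
  have : (-(423 / 1000 : ℝ)) < (-(383 / 1250 : ℝ)) := by norm_num
  linarith [h.1, hmem.2]

end Summit.Ventures.CertifiedManyBodySolver.Downfold.Emery
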